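import Literature.AlgebraicGeometry.Resolution.CoordinateBlowupChart
import Literature.AlgebraicGeometry.Resolution.BlowupAlgebraStrictTransform
import Mathlib.Algebra.MvPolynomial.Division
import Mathlib.Algebra.MvPolynomial.Equiv
import Mathlib.RingTheory.Polynomial.Quotient
import Mathlib.RingTheory.RegularLocalRing.Polynomial
import HarnessLib

/-!
# Crux `PatchingRelPerfect` (stmt-ResolutionOfSingularities-16161), chain w52 — rung tool r2Σ-a,
# part 1: the suspension ring, Hu's substitution on it, non-divisibility of strict transforms,
# the graph quotient

[OURS · L1 W5.2 · rung tool] Preliminaries for the Σ-calculus chart lemma of CORE-MECHANISM-NOTE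
§3a (file `…SigmaCalculusCharts.lean`).  Variables `σ = Option (Option τ)` with `s := none`,
`u := some none` and base variables `base t := some (some t)`; for a coordinate centre
`C = V(X_j : j ∈ A₀)` of `S[X_τ]` the LIFTED centre `C × {u = s = 0}` is the variable set
`centre = {s, u} ∪ base '' A₀`.  PROVED (any commutative ring `S`, any `τ`):

* `coordBlowupSubst_base_rename`, `coordBlowupSubst_u_rename` — Hu's blow-up substitution
  (`coordBlowupSubst`, tree `CoordinateBlowupChart.lean`) of the chart of a base centre variable,
  resp. of `u`, commutes with `rename base` (resp. factors through `rename some`);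
* `exists_coordBlowupSubst_eq_pow_mul`, `rename_some_mem_pow` — the chart transform of
  `p ∈ (X_j : j ∈ A)^ν` is divisible by `X_{i₀}^ν`;
* `not_X_base_dvd`, `not_X_u_dvd` — the strict transforms `w^μ G′ - X_u X_s`, `X_u^μ G̃ - X_s`
  are NOT divisible by the exceptional variable (coefficient of `X_u X_s`, resp. `X_s`, is `-1`);
* `nonempty_quotientGraphEquiv` — the graph quotient
  `S[X_{Option T}] ⧸ (X_none - rename some Q) ≅ S[X_T]` (`optionEquivLeft` +
  `Polynomial.quotientSpanXSubCAlgEquiv`).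

No definitions (local notation only).  Nothing here is a statement of the manuscript under review.

## References

* Y. Hu, arXiv:2507.21400 (2025), §5 Prop. 5.3. [Hu2025]
* U. Görtz, T. Wedhorn, *Algebraic Geometry I* (2nd ed., 2020), (13.19) p. 415. [GortzWedhorn2020]
-/

-- `Summit.<Summit>.<Sub>.Theorems` with `Sub = Summit` (single-conjunct summit, D-0017)
set_option linter.dupNamespace false

noncomputable section

open MvPolynomial Literature.AlgebraicGeometry.Resolution

namespace Summit.ResolutionOfSingularities.ResolutionOfSingularities.Theorems

namespace SigmaCalculus

universe u v

variable (S : Type u) [CommRing S] {τ : Type v}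

/-! ## The variables: `σ = Option (Option τ)`, `s = none`, `u = some none`, base `some (some t)` -/

/-- The base embedding `t ↦ some (some t)` of the variables is injective. [folklore] -/
theorem some_some_injective :
    Function.Injective (fun t : τ => (some (some t) : Option (Option τ))) :=
  fun _ _ h => Option.some_injective _ (Option.some_injective _ h)

/-- A base variable is not `s = none`. [folklore] -/
theorem some_some_ne_none (t : τ) : (some (some t) : Option (Option τ)) ≠ none :=
  Option.some_ne_none _

/-- A base variable is not `u = some none`. [folklore] -/
theorem some_some_ne_some_none (t : τ) : (some (some t) : Option (Option τ)) ≠ some none :=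
  fun h => Option.some_ne_none t (Option.some_injective _ h)

/-- `s = none` lies in the lifted centre. [folklore] -/
theorem none_mem_centre (A₀ : Set τ) :
    (none : Option (Option τ)) ∈
      insert none (insert (some none) ((fun t : τ => (some (some t) : Option (Option τ))) '' A₀)) :=
  Set.mem_insert _ _

/-- `u = some none` lies in the lifted centre. [folklore] -/
theorem some_none_mem_centre (A₀ : Set τ) :
    (some none : Option (Option τ)) ∈
      insert none (insert (some none) ((fun t : τ => (some (some t) : Option (Option τ))) '' A₀)) :=
  Set.mem_insert_of_mem _ (Set.mem_insert _ _)

/-- Membership of a base variable in the lifted centre `{s, u} ∪ base '' A₀`. [folklore] -/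
theorem some_some_mem_centre_iff (A₀ : Set τ) (t : τ) :
    (some (some t) : Option (Option τ)) ∈
      insert none (insert (some none) ((fun t : τ => (some (some t) : Option (Option τ))) '' A₀)) ↔
      t ∈ A₀ := by
  simp only [Set.mem_insert_iff, some_some_ne_none, some_some_ne_some_none, false_or]
  exact some_some_injective.mem_set_image

section Setting

variable (A₀ : Set τ)

/-- the base embedding of the variables -/
local notation3 "base" => (fun t : τ => (some (some t) : Option (Option τ)))
/-- the lifted centre `C × {u = s = 0}` as a set of variables -/
local notation3 "centre" =>
  insert none (insert (some none) ((fun t : τ => (some (some t) : Option (Option τ))) '' A₀))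

/-! ## Hu's substitution on the suspension ring: commuting with `rename` -/

/-- On base polynomials, the substitution of the chart of a base centre variable `X_{base j₀}`
for the lifted centre is the substitution of the chart of `X_{j₀}` for `C` downstairs:
`subst_{centre, base j₀} (rename base p) = rename base (subst_{A₀, j₀} p)`. [folklore] -/
theorem coordBlowupSubst_base_rename (j₀ : τ) (p : MvPolynomial τ S) :
    coordBlowupSubst S (centre) (base j₀) (rename base p) =
      rename base (coordBlowupSubst S A₀ j₀ p) := by
  classical
  have h : (coordBlowupSubst S (centre) (base j₀)).comp (rename base) =
      (rename base).comp (coordBlowupSubst S A₀ j₀) := by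
    apply MvPolynomial.algHom_ext
    intro t
    simp only [AlgHom.comp_apply, rename_X, coordBlowupSubst_X, some_some_mem_centre_iff,
      some_some_injective.ne_iff]
    split_ifs <;> simp
  exact congrArg (fun φ : MvPolynomial τ S →ₐ[S] _ => φ p) h

/-- On base polynomials, the substitution of the `u`-chart (`u = some none`) for the lifted
centre is the substitution, one level down in `S[X_{Option τ}]`, of the chart of `none` for the
centre `{none} ∪ some '' A₀`, transported along `rename some`. [folklore] -/
theorem coordBlowupSubst_u_rename (p : MvPolynomial τ S) :
    coordBlowupSubst S (centre) (some none) (rename base p) =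
      rename some (coordBlowupSubst S (insert none (some '' A₀)) none (rename some p)) := by
  classical
  have h : (coordBlowupSubst S (centre) (some none)).comp (rename base) =
      ((rename some).comp (coordBlowupSubst S (insert none (some '' A₀)) none)).comp
        (rename some) := by
    apply MvPolynomial.algHom_ext
    intro t
    have h1 : (some t : Option τ) ∈ insert none (some '' A₀) ↔ t ∈ A₀ := by
      simp only [Set.mem_insert_iff, reduceCtorEq, false_or]
      exact (Option.some_injective _).mem_set_image
    simp only [AlgHom.comp_apply, rename_X, coordBlowupSubst_X, some_some_mem_centre_iff, h1]
    split_ifs with h2 h3 h3 <;> simp_all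
  exact congrArg (fun φ : MvPolynomial τ S →ₐ[S] _ => φ p) h

/-! ## Existence of the chart transforms -/

/-- **The chart transform exists**: if `p ∈ (X_j : j ∈ A)^ν` and `i₀ ∈ A`, then Hu's substitution
of the chart of `X_{i₀}` carries `p` into `(X_{i₀}^ν)`: `subst p = X_{i₀}^ν · p′`.
[cite: Hu2025, §5 Prop. 5.3] -/
theorem exists_coordBlowupSubst_eq_pow_mul {ι : Type v} (A : Set ι) {i₀ : ι} (hi₀ : i₀ ∈ A)
    {p : MvPolynomial ι S} {ν : ℕ} (hp : p ∈ Ideal.span (X '' A) ^ ν) :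
    ∃ p' : MvPolynomial ι S, coordBlowupSubst S A i₀ p = X i₀ ^ ν * p' := by
  have h := Ideal.mem_map_of_mem (coordBlowupSubst S A i₀) hp
  rw [Ideal.map_pow, map_coordBlowupSubst_span_eq S A i₀ hi₀, Ideal.span_singleton_pow,
    Ideal.mem_span_singleton'] at h
  obtain ⟨p', hp'⟩ := h
  exact ⟨p', by rw [← hp', mul_comm]⟩

/-- The lifted form: `g ∈ (X_j : j ∈ A₀)^ν` gives `rename some g ∈ (X_i : i ∈ {none} ∪ some '' A₀)^ν`
one level up. [folklore] -/
theorem rename_some_mem_pow {g : MvPolynomial τ S} {ν : ℕ}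
    (hg : g ∈ Ideal.span (X '' A₀) ^ ν) :
    rename (some : τ → Option τ) g ∈
      Ideal.span (X '' (insert none (some '' A₀)) : Set (MvPolynomial (Option τ) S)) ^ ν := by
  have h := Ideal.mem_map_of_mem (rename (some : τ → Option τ)) hg
  rw [Ideal.map_pow, Ideal.map_span] at h
  refine Ideal.pow_right_mono ?_ ν h
  apply Ideal.span_mono
  rintro _ ⟨_, ⟨t, ht, rfl⟩, rfl⟩
  exact ⟨some t, Set.mem_insert_of_mem _ ⟨t, ht, rfl⟩, (rename_X _ _).symm⟩

/-! ## Non-divisibility of the strict transforms by the exceptional variable -/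

/-- The coefficient of a monomial involving `s = none` (resp. not in the range of the renaming)
in a renamed polynomial vanishes. [folklore] -/
theorem coeff_rename_eq_zero_of_ne_zero {ι κ : Type v} (f : ι → κ) (p : MvPolynomial ι S)
    (d : κ →₀ ℕ) {k : κ} (hk : k ∉ Set.range f) (hd : d k ≠ 0) :
    coeff d (rename f p) = 0 := by
  refine coeff_rename_eq_zero f p d fun e he => ?_
  exfalso
  apply hd
  rw [← he, Finsupp.mapDomain_notin_range _ _ hk]

/-- **`X_w ∤ X_w^μ · G′ - X_u X_s`** for a base variable `w` and `G′` a base polynomial: the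
coefficient of the monomial `X_u X_s` is `-1` on the right and `0` on any multiple of `X_w`.
[folklore] -/
theorem not_X_base_dvd [Nontrivial S] (j₀ : τ) (μ : ℕ) (p : MvPolynomial τ S) :
    ¬ (X (base j₀) : MvPolynomial (Option (Option τ)) S) ∣
      X (base j₀) ^ μ * rename base p - X (some none) * X none := by
  classical
  rintro ⟨h, hh⟩
  let m₀ : Option (Option τ) →₀ ℕ := Finsupp.single (some none) 1 + Finsupp.single none 1
  have h1 : coeff m₀ (X (base j₀) * h) = 0 := by
    rw [coeff_X_mul', if_neg]
    simp [m₀, Finsupp.mem_support_iff]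
  have h2 : coeff m₀ (X (base j₀) ^ μ * rename base p) = 0 := by
    have hr : X (base j₀) ^ μ * rename base p = rename base (X j₀ ^ μ * p) := by
      simp only [map_mul, map_pow, rename_X]
    rw [hr]
    refine coeff_rename_eq_zero_of_ne_zero S base _ m₀ (k := none) ?_ ?_
    · rintro ⟨t, ht⟩; exact some_some_ne_none t ht
    · simp [m₀]
  have h3 : coeff m₀ (X (some none) * X none : MvPolynomial (Option (Option τ)) S) = 1 := by
    rw [coeff_X_mul', if_pos (by simp [m₀, Finsupp.mem_support_iff])]
    have : m₀ - Finsupp.single (some none) 1 = Finsupp.single none 1 := by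
      simp [m₀]
    rw [this, coeff_X, if_pos rfl]
  have h4 := congrArg (coeff m₀) hh
  rw [coeff_sub, h2, h3, h1, zero_sub] at h4
  exact one_ne_zero (neg_eq_zero.mp h4)

/-- **`X_u ∤ X_u^μ · G̃ - X_s`** for `G̃` free of `s` (a `rename some`): the coefficient of `X_s`.
[folklore] -/
theorem not_X_u_dvd [Nontrivial S] (μ : ℕ) (p : MvPolynomial (Option τ) S) :
    ¬ (X (some none) : MvPolynomial (Option (Option τ)) S) ∣
      X (some none) ^ μ * rename some p - X none := by
  classical
  rintro ⟨h, hh⟩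
  let m₁ : Option (Option τ) →₀ ℕ := Finsupp.single none 1
  have h1 : coeff m₁ (X (some none) * h) = 0 := by
    rw [coeff_X_mul', if_neg]
    simp [m₁]
  have h2 : coeff m₁ (X (some none) ^ μ * rename some p) = 0 := by
    have hr : X (some none) ^ μ * rename some p =
        rename (some : Option τ → Option (Option τ)) (X none ^ μ * p) := by
      simp only [map_mul, map_pow, rename_X]
    rw [hr]
    refine coeff_rename_eq_zero_of_ne_zero S some _ m₁ (k := none) ?_ ?_
    · rintro ⟨t, ht⟩; exact Option.some_ne_none t ht
    · simp [m₁]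
  have h3 : coeff m₁ (X none : MvPolynomial (Option (Option τ)) S) = 1 := by
    rw [coeff_X, if_pos rfl]
  have h4 := congrArg (coeff m₁) hh
  rw [coeff_sub, h2, h3, h1, zero_sub] at h4
  exact one_ne_zero (neg_eq_zero.mp h4)

/-! ## The graph quotient `S[X_{Option T}] ⧸ (X_none - rename some Q) ≅ S[X_T]` -/

/-- `optionEquivLeft` sends base polynomials to constants: `optionEquivLeft (rename some Q) = C Q`.
[folklore] -/
theorem optionEquivLeft_rename_some {T : Type v} (Q : MvPolynomial T S) :
    optionEquivLeft S T (rename some Q) = Polynomial.C Q := by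
  have h : (optionEquivLeft S T).toAlgHom.comp (rename some) =
      (Polynomial.CAlgHom : MvPolynomial T S →ₐ[S] Polynomial (MvPolynomial T S)) := by
    apply MvPolynomial.algHom_ext
    intro t
    simp [optionEquivLeft_X_some]
  exact congrArg (fun φ : MvPolynomial T S →ₐ[S] _ => φ Q) h

/-- **The graph quotient**: for `Q ∈ S[X_T]`, `S[X_{Option T}] ⧸ (X_{none} - rename some Q) ≅ S[X_T]`
(eliminate the variable `X_none = Q`). [folklore] -/
theorem nonempty_quotientGraphEquiv {T : Type v} (Q : MvPolynomial T S) :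
    Nonempty ((MvPolynomial (Option T) S ⧸ Ideal.span {X none - rename some Q}) ≃+*
      MvPolynomial T S) :=
  ⟨(Ideal.quotientEquiv (Ideal.span {X none - rename some Q})
      (Ideal.span {Polynomial.X - Polynomial.C Q}) (optionEquivLeft S T).toRingEquiv (by
        rw [Ideal.map_span, Set.image_singleton]
        congr 2
        change Polynomial.X - Polynomial.C Q = (optionEquivLeft S T) (X none - rename some Q)
        rw [map_sub, optionEquivLeft_X_none, optionEquivLeft_rename_some])).trans
    (Polynomial.quotientSpanXSubCAlgEquiv Q).toRingEquiv⟩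

end Setting

end SigmaCalculus

end Summit.ResolutionOfSingularities.ResolutionOfSingularities.Theorems

end
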